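import Summits.ResolutionOfSingularities.ResolutionOfSingularities.Theorems.WeightedInvariantIota3TieLocusNormal
import Summits.ResolutionOfSingularities.ResolutionOfSingularities.Theorems.WeightedInvariantSuccessorRatioBoundContact
import Mathlib.Algebra.Ring.GeomSum
import HarnessLib

/-!
# (STEEP), first step — PINNING OF THE FIRST MEMBER: a steep one-flag reach of `g = c·W^ν + t⁻¹·H` at the pinned successor is led by a
# parameter `g₁ ≡ α·t⁻¹ + δ·W (mod z·𝔪 + 𝔪²)` (door `HypersurfaceCentreConstruction`, stmt-ResolutionOfSingularities-19897)

Helper for `stub_keyRungGrHomLE_three` (def-free, `--supports 19897`).  First step of the residual (STEEP) of this hand's gap list of record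
`keyRungGrHomLE_three_of_tieDescent_point_steep` (…KeyRungThreeOfDropCurveSteep; SIGMA-ISO.md §2 (b)): by the tangent-cone dichotomy
(`RatContact.exists_sub_mul_pow_mem_of_mem_ratContactFiltration`) a steep reach `g ∈ ratContactFiltration g₁ a b (aν)`, `b < a`, gives
`g − c₁ g₁^ν ∈ 𝔪^{ν+1}`; this file shows what that forces on `g₁` when `g = c W^ν + T H` in a regular local threefold `L` with `𝔪 = (T, z, W)`:

* **`Iota3.isUnit_of_sub_mul_pow_mem_pow_succ`** — the cofactor `c₁` is a unit (else `g ∈ 𝔪^{ν+1}`, but `ord g = ν`: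
  `unit_mul_pow_add_mul_not_mem_pow_succ`).
* **`Iota3.pow_sub_pow_mem_weightedMonomialIdeal`** — `(γz + m)^ν − (γz)^ν ∈ 𝒥_{ν+1}` for `m ∈ 𝒥₂` of a weighted filtration on a
  system of generators of `𝔪` with weights `≥ 1` (geometric sum).
* **`Iota3.coeff_z_mem_maximalIdeal_of_steep`** — **PINNING**: writing `g₁ = α T + γ z + δ W`, the `z`-coefficient `γ` lies in `𝔪`.
  (Weights `(T, z, W) ↦ (ν+1, 1, 2)`: `𝔪^{ν+1} + (T) + (W^ν) ⊆ 𝒥_{ν+1}` and `g₁^ν ≡ γ^ν z^ν (mod 𝒥_{ν+1})`, so `c₁γ^ν z^ν ∈ 𝒥_{1·ν+1}` and weighted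
  quasi-regularity (`mem_maximalIdeal_of_monomial_mem`) gives `c₁γ^ν ∈ 𝔪`.)  So the initial form of `g₁` lies in the plane `κ T̄ ⊕ κ W̄` of
  `𝔪/𝔪²`: the only flags that can be steep for the transform are the `W`-LED ones (`δ` a unit, since `g₁ ∉ 𝔪²` and `T`-led flags … ) or
  `T`-led ones — the case analysis of (STEEP) starts here.
* **`Iota3.coeff_z_mem_maximalIdeal_of_mem_ratContactFiltration`** — the same from the reach itself.

[OURS · L1 W4.3 · kernel lemmas; AI work, weaker than expert review; nothing here is a statement of the manuscript under review
(Hironaka 2017, [claim: Hironaka2017, status: under-review]).]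

## References

* H. Matsumura, *Commutative Ring Theory*, CUP 1986, Thm. 16.2 (quasi-regularity). [Matsumura1987]
* H. Hironaka, *Characteristic polyhedra of singularities*, J. Math. Kyoto Univ. 7 (1967), §3 (tangent cone and contact). [Hironaka1967]
-/

noncomputable section

set_option linter.dupNamespace false -- mandated namespace of this single-conjunct summit

open IsLocalRing Literature.AlgebraicGeometry.Resolution
open Summit.ResolutionOfSingularities.ResolutionOfSingularities.Theorems
open Summit.ResolutionOfSingularities.ResolutionOfSingularities.Cruxes.HypersurfaceCentreConstruction.LocalEngine.Iota3.RatContact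

namespace Summit.ResolutionOfSingularities.ResolutionOfSingularities.Cruxes.HypersurfaceCentreConstruction.LocalEngine

namespace Iota3

section Pinning

variable {L : Type} [CommRing L] [IsRegularLocalRing L]

/-- In a regular local threefold with `𝔪 = (T, z, W)`: `c W^ν + T H ∉ 𝔪^{ν+1}` for a unit `c` (weighted quasi-regularity for the weights
`(ν+1, 1, 1)`). [cite: Matsumura1987, Thm. 16.2] -/
theorem unit_mul_pow_add_mul_not_mem_pow_succ' (hdim : ringKrullDim L = (3 : ℕ)) {T z W c H : L}
    (hspan : Ideal.span {T, z, W} = maximalIdeal L) (hc : IsUnit c) (ν : ℕ) : c * W ^ ν + T * H ∉ maximalIdeal L ^ (ν + 1) := by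
  intro hmem
  have hu : Ideal.span (Set.range ![T, z, W]) = maximalIdeal L := by rw [range_three]; exact hspan
  have hw : ∀ i, 0 < (![ν + 1, 1, 1] : Fin 3 → ℕ) i := fun i => by fin_cases i <;> simp
  have hle : maximalIdeal L ^ (ν + 1) ≤ weightedMonomialIdeal ![T, z, W] ![ν + 1, 1, 1] (ν + 1) :=
    pow_le_weightedMonomialIdeal_of_span_eq _ _ hw hu (ν + 1)
  have hT : T * H ∈ weightedMonomialIdeal ![T, z, W] ![ν + 1, 1, 1] (ν + 1) :=
    Ideal.mul_mem_right _ _ (self_mem_weightedMonomialIdeal ![T, z, W] ![ν + 1, 1, 1] 0)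
  have hmono : c * W ^ ν ∈ weightedMonomialIdeal ![T, z, W] ![ν + 1, 1, 1] ((![ν + 1, 1, 1] : Fin 3 → ℕ) 2 * ν + 1) := by
    have h1 : c * W ^ ν = (c * W ^ ν + T * H) - T * H := by ring
    rw [show (![ν + 1, 1, 1] : Fin 3 → ℕ) 2 * ν + 1 = ν + 1 by simp, h1]
    exact Ideal.sub_mem _ (hle hmem) hT
  have hcm : c ∈ maximalIdeal L := mem_maximalIdeal_of_monomial_mem ![T, z, W] hu hdim ![ν + 1, 1, 1] hw 2 ν hmono
  exact ((IsLocalRing.mem_maximalIdeal c).mp hcm) hc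

/-- **The cofactor of a tangent-cone approximation is a unit**: if `g = c W^ν + T H` (`c` a unit, `𝔪 = (T, z, W)`, `L` regular of dimension
three) and `g − c₁ g₁^ν ∈ 𝔪^{ν+1}` with `g₁ ∈ 𝔪`, then `c₁` is a unit. [OURS · L1 W4.3] -/
theorem isUnit_of_sub_mul_pow_mem_pow_succ (hdim : ringKrullDim L = (3 : ℕ)) {T z W c H g₁ c₁ : L}
    (hspan : Ideal.span {T, z, W} = maximalIdeal L) (hc : IsUnit c) {ν : ℕ} (hg₁ : g₁ ∈ maximalIdeal L)
    (h : c * W ^ ν + T * H - c₁ * g₁ ^ ν ∈ maximalIdeal L ^ (ν + 1)) : IsUnit c₁ := by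
  by_contra hc₁
  have hc₁m : c₁ ∈ maximalIdeal L := (IsLocalRing.mem_maximalIdeal c₁).mpr hc₁
  have h1 : c₁ * g₁ ^ ν ∈ maximalIdeal L ^ (ν + 1) := by
    rw [pow_succ']
    exact Ideal.mul_mem_mul hc₁m (Ideal.pow_mem_pow hg₁ ν)
  have h2 : c * W ^ ν + T * H ∈ maximalIdeal L ^ (ν + 1) := by
    have h3 := Ideal.add_mem _ h h1
    rwa [sub_add_cancel] at h3
  exact unit_mul_pow_add_mul_not_mem_pow_succ' hdim hspan hc ν h2

omit [IsRegularLocalRing L] in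
/-- **`(x + m)^ν − x^ν ∈ 𝒥_{ν+1}`** for a weighted filtration `𝒥` on generators `u` of `𝔪` with weights `≥ 1`, `x, m ∈ 𝔪`, `m ∈ 𝒥₂` (geometric sum:
the difference is `m` times a sum of products of `ν − 1` elements of `𝔪`). [folklore] -/
theorem add_pow_sub_pow_mem_weightedMonomialIdeal_succ [IsLocalRing L] {d : ℕ} (u : Fin d → L) (w : Fin d → ℕ) (hw : ∀ i, 0 < w i)
    (hu : Ideal.span (Set.range u) = maximalIdeal L) {x m : L} (hx : x ∈ maximalIdeal L) (hm𝔪 : m ∈ maximalIdeal L)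
    (hm : m ∈ weightedMonomialIdeal u w 2) (ν : ℕ) :
    (x + m) ^ ν - x ^ ν ∈ weightedMonomialIdeal u w (ν + 1) := by
  have hxm : x + m ∈ maximalIdeal L := Ideal.add_mem _ hx hm𝔪
  have hgeom : (∑ i ∈ Finset.range ν, (x + m) ^ i * x ^ (ν - 1 - i)) * ((x + m) - x) = (x + m) ^ ν - x ^ ν :=
    Commute.geom_sum₂_mul (Commute.all _ _) ν
  rw [← hgeom, add_sub_cancel_left]
  have hK : ∑ i ∈ Finset.range ν, (x + m) ^ i * x ^ (ν - 1 - i) ∈ maximalIdeal L ^ (ν - 1) := by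
    refine Ideal.sum_mem _ fun i hi => ?_
    have hi' : i ≤ ν - 1 := by have := Finset.mem_range.mp hi; omega
    have h1 : (x + m) ^ i * x ^ (ν - 1 - i) ∈ maximalIdeal L ^ (i + (ν - 1 - i)) := by
      rw [pow_add]
      exact Ideal.mul_mem_mul (Ideal.pow_mem_pow hxm i) (Ideal.pow_mem_pow hx _)
    rwa [Nat.add_sub_cancel' hi'] at h1
  have hK' : ∑ i ∈ Finset.range ν, (x + m) ^ i * x ^ (ν - 1 - i) ∈ weightedMonomialIdeal u w (ν - 1) :=
    pow_le_weightedMonomialIdeal_of_span_eq u w hw hu (ν - 1) hK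
  have h := weightedMonomialIdeal_mul_le u w (ν - 1) 2 (Ideal.mul_mem_mul hK' hm)
  exact weightedMonomialIdeal_antitone u w (by omega) h

/-- **PINNING OF THE FIRST MEMBER**: `L` regular local of dimension three, `𝔪 = (T, z, W)`, `g = c W^ν + T H` with `c` a unit, and
`g − c₁ g₁^ν ∈ 𝔪^{ν+1}` (a tangent-cone approximation, `c₁` any).  Writing `g₁ = α T + γ z + δ W`: **`c₁ γ^ν ∈ 𝔪`**; if `g₁ ∈ 𝔪` then `c₁` is a
unit and **`γ ∈ 𝔪`** — the initial form of `g₁` lies in `κ T̄ ⊕ κ W̄`. [OURS · L1 W4.3 · (STEEP) step 1] [cite: Matsumura1987, Thm. 16.2] -/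
theorem coeff_z_mem_maximalIdeal_of_steep (hdim : ringKrullDim L = (3 : ℕ)) {T z W c H α γ δ c₁ : L}
    (hspan : Ideal.span {T, z, W} = maximalIdeal L) (hc : IsUnit c) {ν : ℕ} (hν : 1 ≤ ν)
    (h : c * W ^ ν + T * H - c₁ * (α * T + γ * z + δ * W) ^ ν ∈ maximalIdeal L ^ (ν + 1)) : γ ∈ maximalIdeal L := by
  classical
  have hu : Ideal.span (Set.range ![T, z, W]) = maximalIdeal L := by rw [range_three]; exact hspan
  have hw : ∀ i, 0 < (![ν + 1, 1, 2] : Fin 3 → ℕ) i := fun i => by fin_cases i <;> simp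
  have hTm : T ∈ maximalIdeal L := hspan ▸ Ideal.subset_span (by simp)
  have hzm : z ∈ maximalIdeal L := hspan ▸ Ideal.subset_span (by simp)
  have hWm : W ∈ maximalIdeal L := hspan ▸ Ideal.subset_span (by simp)
  have hg₁ : α * T + γ * z + δ * W ∈ maximalIdeal L :=
    Ideal.add_mem _ (Ideal.add_mem _ (Ideal.mul_mem_left _ _ hTm) (Ideal.mul_mem_left _ _ hzm)) (Ideal.mul_mem_left _ _ hWm)
  have hc₁ : IsUnit c₁ := isUnit_of_sub_mul_pow_mem_pow_succ hdim hspan hc hg₁ h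
  -- the filtration `𝒥` with weights `(ν+1, 1, 2)` on `(T, z, W)`
  set J := weightedMonomialIdeal ![T, z, W] ![ν + 1, 1, 2] with hJ
  have hle : maximalIdeal L ^ (ν + 1) ≤ J (ν + 1) := pow_le_weightedMonomialIdeal_of_span_eq _ _ hw hu (ν + 1)
  have hT : T ∈ J (ν + 1) := self_mem_weightedMonomialIdeal ![T, z, W] ![ν + 1, 1, 2] 0
  have hW : W ∈ J 2 := self_mem_weightedMonomialIdeal ![T, z, W] ![ν + 1, 1, 2] 2
  have hWν : c * W ^ ν ∈ J (ν + 1) := by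
    refine Ideal.mul_mem_left _ _ (weightedMonomialIdeal_antitone _ _ (show ν + 1 ≤ 2 * ν by omega) ?_)
    have h := Summit.ResolutionOfSingularities.ResolutionOfSingularities.Theorems.pow_mem_weightedMonomialIdeal ![T, z, W] ![ν + 1, 1, 2] hW ν
    simpa only [Nat.mul_comm 2 ν] using h
  -- `g₁ = γ z + m` with `m = α T + δ W ∈ J 2`
  have hm : α * T + δ * W ∈ J 2 :=
    Ideal.add_mem _ (Ideal.mul_mem_left _ _ (weightedMonomialIdeal_antitone _ _ (show 2 ≤ ν + 1 by omega) hT))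
      (Ideal.mul_mem_left _ _ hW)
  have hm𝔪 : α * T + δ * W ∈ maximalIdeal L := Ideal.add_mem _ (Ideal.mul_mem_left _ _ hTm) (Ideal.mul_mem_left _ _ hWm)
  have hpow : (γ * z + (α * T + δ * W)) ^ ν - (γ * z) ^ ν ∈ J (ν + 1) :=
    add_pow_sub_pow_mem_weightedMonomialIdeal_succ ![T, z, W] ![ν + 1, 1, 2] hw hu (Ideal.mul_mem_left _ _ hzm) hm𝔪 hm ν
  -- hence `c₁ γ^ν z^ν ∈ J (ν + 1) = J (1·ν + 1)`
  have hmono : c₁ * γ ^ ν * z ^ ν ∈ weightedMonomialIdeal ![T, z, W] ![ν + 1, 1, 2] ((![ν + 1, 1, 2] : Fin 3 → ℕ) 1 * ν + 1) := by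
    rw [show (![ν + 1, 1, 2] : Fin 3 → ℕ) 1 * ν + 1 = ν + 1 by simp]
    have h1 : c₁ * γ ^ ν * z ^ ν =
        c₁ * (α * T + γ * z + δ * W) ^ ν - c₁ * ((γ * z + (α * T + δ * W)) ^ ν - (γ * z) ^ ν) := by ring
    have h2 : c₁ * (α * T + γ * z + δ * W) ^ ν = (c * W ^ ν + T * H) - (c * W ^ ν + T * H - c₁ * (α * T + γ * z + δ * W) ^ ν) := by
      ring
    rw [h1, h2]
    exact Ideal.sub_mem _ (Ideal.sub_mem _ (Ideal.add_mem _ hWν (Ideal.mul_mem_right _ _ hT)) (hle h))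
      (Ideal.mul_mem_left _ _ hpow)
  have hcγ : c₁ * γ ^ ν ∈ maximalIdeal L := mem_maximalIdeal_of_monomial_mem ![T, z, W] hu hdim ![ν + 1, 1, 2] hw 1 ν hmono
  have hγν : γ ^ ν ∈ maximalIdeal L := by
    rcases (Ideal.IsPrime.mem_or_mem inferInstance hcγ) with h1 | h1
    · exact absurd h1 ((IsLocalRing.mem_maximalIdeal c₁).not.mpr (not_not.mpr hc₁))
    · exact h1
  exact Ideal.IsPrime.mem_of_pow_mem inferInstance ν hγν

/-- **PINNING, from the reach**: a steep one-flag reach `g ∈ ratContactFiltration g₁ a b (aν)` (`0 < b < a`) of `g = c W^ν + T H` along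
`g₁ = α T + γ z + δ W` forces `γ ∈ 𝔪`. [OURS · L1 W4.3 · (STEEP) step 1] [cite: Hironaka1967, §3] -/
theorem coeff_z_mem_maximalIdeal_of_mem_ratContactFiltration (hdim : ringKrullDim L = (3 : ℕ)) {T z W c H α γ δ : L}
    (hspan : Ideal.span {T, z, W} = maximalIdeal L) (hc : IsUnit c) {ν a b : ℕ} (hν : 1 ≤ ν) (hb : 0 < b) (hab : b < a)
    (hreach : c * W ^ ν + T * H ∈ ratContactFiltration (α * T + γ * z + δ * W) a b (a * ν)) : γ ∈ maximalIdeal L := by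
  have hTm : T ∈ maximalIdeal L := hspan ▸ Ideal.subset_span (by simp)
  have hzm : z ∈ maximalIdeal L := hspan ▸ Ideal.subset_span (by simp)
  have hWm : W ∈ maximalIdeal L := hspan ▸ Ideal.subset_span (by simp)
  have hg₁ : α * T + γ * z + δ * W ∈ maximalIdeal L :=
    Ideal.add_mem _ (Ideal.add_mem _ (Ideal.mul_mem_left _ _ hTm) (Ideal.mul_mem_left _ _ hzm)) (Ideal.mul_mem_left _ _ hWm)
  obtain ⟨c₁, hc₁⟩ := exists_sub_mul_pow_mem_of_mem_ratContactFiltration hg₁ hb hab hreach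
  exact coeff_z_mem_maximalIdeal_of_steep hdim hspan hc hν hc₁

end Pinning

end Iota3

end Summit.ResolutionOfSingularities.ResolutionOfSingularities.Cruxes.HypersurfaceCentreConstruction.LocalEngine

end
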